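import Summits.AtomisticToContinuum.HydrodynamicLimit.Theorems.AntiMazurCoboundariesPressureCertificateTransfer

/-!
# The Fejér corrector defect identity along good orbits

Route `AntiMazurCoboundaries` of `AtomisticToContinuum/HydrodynamicLimit`, support item
stmt-AtomisticToContinuum-13917 (`LocalCertificateTransfer`), plan step (2) — the EXACT IDENTITY for the
true-flow Fejér corrector. Helper lemmas (`--supports`); pure real analysis plus the group property of the
flow on its good set, no dynamics.

For a bounded measurable signal `Ψ : ℝ → ℝ` (an observable read along an orbit), horizon `H > 0` and the
Fejér integral `V(r) = ∫₀ᴴ (1 − t/H) Ψ(t + r) dt`: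

* `FejerDefect.integral_fejer_eq` — `V(r) = H⁻¹ ∫_r^{r+H} (∫_r^w Ψ) dw` (Fubini on the triangle
  `r < t ≤ w ≤ r + H`: the Fejér weight is `H⁻¹ · |{w : t ≤ w ≤ r+H}|`);
* `FejerDefect.fejer_sub_fejer` — `V(s) − V(0) = H⁻¹ ∫₀ˢ (∫_u^{u+H} Ψ) du − ∫₀ˢ Ψ`
  (interval additivity and the shift `w ↦ u + H`; no differentiability of `Ψ` is used);
* `FejerDefect.defect_identity_of_flow` — for a flow with the group property on an invariant good set, a
  bounded observable `F` measurable along the good orbit of `z`, the Fejér corrector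
  `W(x) = −∫₀ᴴ (1 − t/H) F(Φ_t x) dt` and a lag `s > 0`:
  `F(z) − s⁻¹(W(Φ_s z) − W(z)) = [F(z) − s⁻¹∫₀ˢ F(Φ_u z) du] + s⁻¹∫₀ˢ H⁻¹∫_u^{u+H} F(Φ_t z) dt du`
  — WITHIN-LAG SHOT NOISE plus the LAG-AVERAGE OF WINDOW-`H` AVERAGES (the `S + B` split of the route
  docstring);
* `FejerDefect.defect_identity` — the same for a hard-sphere flow on `𝕋³` and a bounded measurable phase
  function (`AntiMazurCertificate.measurable_flow_orbit` supplies measurability along good orbits).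

References: Kipnis–Landim, *Scaling Limits of Interacting Particle Systems* (1999), Ch. 2 §5–6 (time
averages and correctors); folklore calculus of Fejér means.
-/

noncomputable section

open MeasureTheory Set
open scoped Interval

namespace Summit.AtomisticToContinuum.HydrodynamicLimit.Theorems

open Literature.Analysis.FluidPDE (HardSphereFlow Config)
open Literature.MathematicalPhysics.KineticTheory (T3)

namespace FejerDefect

variable {Ψ : ℝ → ℝ} {C : ℝ}

/-- A bounded measurable signal is integrable on every bounded interval. [folklore] -/
theorem intervalIntegrable_of_abs_le (hΨm : Measurable Ψ) (hC : ∀ t, |Ψ t| ≤ C) (a b : ℝ) :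
    IntervalIntegrable Ψ volume a b := by
  rw [intervalIntegrable_iff]
  refine IntegrableOn.of_bound ?_ hΨm.aestronglyMeasurable C (ae_of_all _ fun t => ?_)
  · rw [uIoc, Real.volume_Ioc]
    exact ENNReal.ofReal_lt_top
  · rw [Real.norm_eq_abs]
    exact hC t

/-- Shift of the Fejér integral: `∫₀ᴴ (1 − t/H) Ψ(t + r) dt = ∫_r^{r+H} (1 − (t − r)/H) Ψ(t) dt`.
[folklore] -/
theorem integral_fejer_comp_add (Ψ : ℝ → ℝ) (H r : ℝ) :
    ∫ t in (0 : ℝ)..H, (1 - t / H) * Ψ (t + r) = ∫ t in r..(r + H), (1 - (t - r) / H) * Ψ t := by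
  have h := intervalIntegral.integral_comp_add_right (a := 0) (b := H)
    (fun t => (1 - (t - r) / H) * Ψ t) r
  simp only [add_sub_cancel_right, zero_add] at h
  rw [h, add_comm H r]

/-- **Fubini on the triangle.** For a bounded measurable signal and `0 ≤ H`:
`∫_r^{r+H} (r + H − t) Ψ(t) dt = ∫_r^{r+H} (∫_r^w Ψ(t) dt) dw`. [folklore] -/
theorem integral_kernel_eq (hΨm : Measurable Ψ) (hC : ∀ t, |Ψ t| ≤ C) {H : ℝ} (hH : 0 ≤ H) (r : ℝ) :
    ∫ t in r..(r + H), (r + H - t) * Ψ t = ∫ w in r..(r + H), ∫ t in r..w, Ψ t := by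
  have hrH : r ≤ r + H := by linarith
  -- the joint integrand `g t w = 1_{t ≤ w} Ψ t`
  set g : ℝ → ℝ → ℝ := fun t w => (Iic w).indicator Ψ t with hgdef
  -- Step 1: the kernel `r + H - t` is the inner `w`-integral of `1_{t ≤ w}` over `(r, r + H]`
  have h1 : ∀ t ∈ Ioc r (r + H), (r + H - t) * Ψ t = ∫ w in r..(r + H), g t w := by
    intro t ht
    rw [intervalIntegral.integral_of_le hrH]
    have hfun : (fun w => g t w) = (Ici t).indicator (fun _ => Ψ t) := by
      funext w
      simp only [hgdef, Set.indicator_apply, mem_Iic, mem_Ici]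
    rw [hfun, setIntegral_indicator measurableSet_Ici, setIntegral_const]
    have hset : Ioc r (r + H) ∩ Ici t = Icc t (r + H) := by
      ext w
      simp only [mem_inter_iff, mem_Ioc, mem_Ici, mem_Icc]
      constructor
      · rintro ⟨⟨_, h2⟩, h3⟩
        exact ⟨h3, h2⟩
      · rintro ⟨h3, h2⟩
        exact ⟨⟨ht.1.trans_le h3, h2⟩, h3⟩
    rw [hset, Measure.real, Real.volume_Icc, ENNReal.toReal_ofReal (by linarith [ht.2]), smul_eq_mul]
  -- Step 2: the inner `t`-integral of `1_{t ≤ w} Ψ t` over `(r, r + H]` is `∫_r^w Ψ`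
  have h3 : ∀ w ∈ Ioc r (r + H), ∫ t in r..(r + H), g t w = ∫ t in r..w, Ψ t := by
    intro w hw
    simp only [hgdef]
    have hset : Ioc r (r + H) ∩ Iic w = Ioc r w := by
      ext t
      simp only [mem_inter_iff, mem_Ioc, mem_Iic]
      constructor
      · rintro ⟨⟨h1', _⟩, h3'⟩
        exact ⟨h1', h3'⟩
      · rintro ⟨h1', h3'⟩
        exact ⟨⟨h1', h3'.trans hw.2⟩, h3'⟩
    rw [intervalIntegral.integral_of_le hrH, intervalIntegral.integral_of_le hw.1.le,
      setIntegral_indicator measurableSet_Iic, hset]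
  -- Step 3: Fubini (the joint integrand is bounded and measurable on a bounded rectangle)
  have hswap : ∫ t in r..(r + H), ∫ w in r..(r + H), g t w =
      ∫ w in r..(r + H), ∫ t in r..(r + H), g t w := by
    refine MeasureTheory.intervalIntegral_intervalIntegral_swap ?_
    have hunc : (Function.uncurry g) = {p : ℝ × ℝ | p.1 ≤ p.2}.indicator fun p => Ψ p.1 := by
      funext p
      simp only [Function.uncurry, hgdef, Set.indicator_apply, mem_Iic, mem_setOf_eq]
    rw [hunc]
    have hmeas : Measurable ({p : ℝ × ℝ | p.1 ≤ p.2}.indicator fun p : ℝ × ℝ => Ψ p.1) :=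
      (hΨm.comp measurable_fst).indicator (measurableSet_le measurable_fst measurable_snd)
    refine IntegrableOn.of_bound ?_ hmeas.aestronglyMeasurable C (ae_of_all _ fun p => ?_)
    · rw [Measure.volume_eq_prod, Measure.prod_prod, uIoc_of_le hrH, Real.volume_Ioc]
      exact ENNReal.mul_lt_top ENNReal.ofReal_lt_top ENNReal.ofReal_lt_top
    · refine (norm_indicator_le_norm_self _ _).trans ?_
      rw [Real.norm_eq_abs]
      exact hC _
  calc ∫ t in r..(r + H), (r + H - t) * Ψ t = ∫ t in r..(r + H), ∫ w in r..(r + H), g t w := by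
        rw [intervalIntegral.integral_of_le hrH, intervalIntegral.integral_of_le hrH]
        exact setIntegral_congr_fun measurableSet_Ioc h1
    _ = ∫ w in r..(r + H), ∫ t in r..(r + H), g t w := hswap
    _ = ∫ w in r..(r + H), ∫ t in r..w, Ψ t := by
        rw [intervalIntegral.integral_of_le hrH, intervalIntegral.integral_of_le hrH]
        exact setIntegral_congr_fun measurableSet_Ioc h3

/-- **The Fejér integral as an average of partial integrals**: for a bounded measurable signal and
`0 < H`, `∫₀ᴴ (1 − t/H) Ψ(t + r) dt = H⁻¹ ∫_r^{r+H} (∫_r^w Ψ(t) dt) dw`. [folklore] -/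
theorem integral_fejer_eq (hΨm : Measurable Ψ) (hC : ∀ t, |Ψ t| ≤ C) {H : ℝ} (hH : 0 < H) (r : ℝ) :
    ∫ t in (0 : ℝ)..H, (1 - t / H) * Ψ (t + r) = H⁻¹ * ∫ w in r..(r + H), ∫ t in r..w, Ψ t := by
  rw [integral_fejer_comp_add, ← integral_kernel_eq hΨm hC hH.le r, ← intervalIntegral.integral_const_mul]
  congr 1
  funext t
  field_simp
  ring

/-- **Difference of Fejér integrals at two starting times** (no differentiability of the signal is
needed): for a bounded measurable `Ψ`, `0 < H` and any `s`,
`∫₀ᴴ (1 − t/H) Ψ(t + s) dt − ∫₀ᴴ (1 − t/H) Ψ(t) dt = H⁻¹ ∫₀ˢ (∫_u^{u+H} Ψ) du − ∫₀ˢ Ψ`. [folklore] -/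
theorem fejer_sub_fejer (hΨm : Measurable Ψ) (hC : ∀ t, |Ψ t| ≤ C) {H : ℝ} (hH : 0 < H) (s : ℝ) :
    (∫ t in (0 : ℝ)..H, (1 - t / H) * Ψ (t + s)) - (∫ t in (0 : ℝ)..H, (1 - t / H) * Ψ t) =
      H⁻¹ * (∫ u in (0 : ℝ)..s, ∫ t in u..(u + H), Ψ t) - ∫ u in (0 : ℝ)..s, Ψ u := by
  have hint : ∀ a b, IntervalIntegrable Ψ volume a b := intervalIntegrable_of_abs_le hΨm hC
  set A : ℝ → ℝ := fun w => ∫ t in (0 : ℝ)..w, Ψ t with hAdef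
  have hA : Continuous A := intervalIntegral.continuous_primitive hint 0
  have hAint : ∀ a b, IntervalIntegrable A volume a b := fun a b => hA.intervalIntegrable a b
  have hsub : ∀ a w, ∫ t in a..w, Ψ t = A w - A a := fun a w =>
    (intervalIntegral.integral_interval_sub_left (hint 0 w) (hint 0 a)).symm
  -- `V(r) = H⁻¹ ∫_r^{r+H} A − A(r)`
  have hV : ∀ r, ∫ t in (0 : ℝ)..H, (1 - t / H) * Ψ (t + r) =
      H⁻¹ * (∫ w in r..(r + H), A w) - A r := by
    intro r
    rw [integral_fejer_eq hΨm hC hH r]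
    simp_rw [hsub r]
    rw [intervalIntegral.integral_sub (hAint r (r + H)) intervalIntegrable_const,
      intervalIntegral.integral_const, smul_eq_mul]
    field_simp
    ring
  have h0 : ∫ t in (0 : ℝ)..H, (1 - t / H) * Ψ t = H⁻¹ * (∫ w in (0 : ℝ)..H, A w) - A 0 := by
    have := hV 0
    simp only [add_zero, zero_add] at this
    exact this
  have hA0 : A 0 = 0 := by simp [hAdef]
  -- `∫_s^{s+H} A − ∫_0^H A = ∫_H^{s+H} A − ∫_0^s A = ∫_0^s (A(u+H) − A u) du`
  have hcomm : (∫ w in s..(s + H), A w) - ∫ w in (0 : ℝ)..H, A w =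
      (∫ u in (0 : ℝ)..s, A (u + H)) - ∫ u in (0 : ℝ)..s, A u := by
    rw [intervalIntegral.integral_interval_sub_interval_comm (hAint _ _) (hAint _ _) (hAint _ _),
      intervalIntegral.integral_symm (0 : ℝ) s, intervalIntegral.integral_symm H (s + H),
      intervalIntegral.integral_comp_add_right (a := 0) (b := s) A H, zero_add]
    ring
  have hshift : IntervalIntegrable (fun u => A (u + H)) volume 0 s :=
    (hA.comp (continuous_id.add continuous_const)).intervalIntegrable _ _
  calc (∫ t in (0 : ℝ)..H, (1 - t / H) * Ψ (t + s)) - (∫ t in (0 : ℝ)..H, (1 - t / H) * Ψ t)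
      = (H⁻¹ * (∫ w in s..(s + H), A w) - A s) - (H⁻¹ * (∫ w in (0 : ℝ)..H, A w) - A 0) := by
        rw [hV s, h0]
    _ = H⁻¹ * ((∫ w in s..(s + H), A w) - ∫ w in (0 : ℝ)..H, A w) - A s := by rw [hA0]; ring
    _ = H⁻¹ * ((∫ u in (0 : ℝ)..s, A (u + H)) - ∫ u in (0 : ℝ)..s, A u) - A s := by rw [hcomm]
    _ = H⁻¹ * (∫ u in (0 : ℝ)..s, (A (u + H) - A u)) - A s := by
        rw [intervalIntegral.integral_sub hshift (hAint _ _)]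
    _ = H⁻¹ * (∫ u in (0 : ℝ)..s, ∫ t in u..(u + H), Ψ t) - ∫ u in (0 : ℝ)..s, Ψ u := by
        simp_rw [hsub]
        rw [hA0, sub_zero]

/-- **The Fejér corrector defect identity along a good orbit** (abstract flow). Let `flow` have the group
property `Φ_{t+s} = Φ_t ∘ Φ_s` on a set `good` containing `z`, let `F` be bounded and measurable along the
orbit of `z`, and let `W(x) = −∫₀ᴴ (1 − t/H) F(Φ_t x) dt` be the Fejér corrector of horizon `H > 0`. Then
for every lag `s`,
`F(z) − s⁻¹ (W(Φ_s z) − W(z)) = [F(z) − s⁻¹ ∫₀ˢ F(Φ_u z) du] + s⁻¹ ∫₀ˢ H⁻¹ ∫_u^{u+H} F(Φ_t z) dt du`: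
the defect of the Fejér corrector is the within-lag shot noise plus the lag-average of the window-`H`
averages. [folklore] -/
theorem defect_identity_of_flow {X : Type*} (flow : ℝ → X → X) (good : Set X)
    (hadd : ∀ s t, ∀ z ∈ good, flow (s + t) z = flow s (flow t z)) (F : X → ℝ) {z : X} (hz : z ∈ good)
    (hΨm : Measurable fun t => F (flow t z)) {C : ℝ} (hC : ∀ x, |F x| ≤ C) {H : ℝ} (hH : 0 < H)
    (W : X → ℝ) (hW : ∀ x, W x = -∫ t in (0 : ℝ)..H, (1 - t / H) * F (flow t x)) (s : ℝ) :
    F z - s⁻¹ * (W (flow s z) - W z) =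
      (F z - s⁻¹ * ∫ u in (0 : ℝ)..s, F (flow u z)) +
        s⁻¹ * ∫ u in (0 : ℝ)..s, H⁻¹ * ∫ t in u..(u + H), F (flow t z) := by
  -- along the orbit, `W(Φ_s z)` is the Fejér integral of the signal `Ψ t = F(Φ_t z)` started at `s`
  have hWs : W (flow s z) = -∫ t in (0 : ℝ)..H, (1 - t / H) * F (flow (t + s) z) := by
    rw [hW]
    congr 1
    refine intervalIntegral.integral_congr fun t _ => ?_
    simp only [hadd t s z hz]
  have hdiff := fejer_sub_fejer (Ψ := fun t => F (flow t z)) hΨm (fun t => hC _) hH s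
  rw [hWs, hW z, intervalIntegral.integral_const_mul]
  simp only at hdiff
  have : -(∫ t in (0 : ℝ)..H, (1 - t / H) * F (flow (t + s) z)) - -∫ t in (0 : ℝ)..H, (1 - t / H) * F (flow t z)
      = -(H⁻¹ * (∫ u in (0 : ℝ)..s, ∫ t in u..(u + H), F (flow t z)) - ∫ u in (0 : ℝ)..s, F (flow u z)) := by
    rw [← hdiff]
    ring
  rw [this]
  ring

/-- **The Fejér corrector defect identity for hard spheres on `𝕋³`.** For a hard-sphere flow `Φ`, a good
initial datum `z`, a bounded measurable phase function `F`, a horizon `H > 0` and any lag `s`, the true-flow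
Fejér corrector `W(x) = −∫₀ᴴ (1 − t/H) F(Φ_t x) dt` satisfies
`F(z) − s⁻¹ (W(Φ_s z) − W(z)) = [F(z) − s⁻¹ ∫₀ˢ F(Φ_u z) du] + s⁻¹ ∫₀ˢ H⁻¹ ∫_u^{u+H} F(Φ_t z) dt du`.
[folklore] -/
theorem defect_identity {N : ℕ} {ε : ℝ}
    (Φ : HardSphereFlow (Literature.Analysis.FluidPDE.Torus.geometry (Fin 3)) ε N)
    {z : Config N (Fin 3) T3} (hz : z ∈ Φ.good) {F : Config N (Fin 3) T3 → ℝ} (hF : Measurable F)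
    {C : ℝ} (hC : ∀ x, |F x| ≤ C) {H : ℝ} (hH : 0 < H) (W : Config N (Fin 3) T3 → ℝ)
    (hW : ∀ x, W x = -∫ t in (0 : ℝ)..H, (1 - t / H) * F (Φ.flow t x)) (s : ℝ) :
    F z - s⁻¹ * (W (Φ.flow s z) - W z) =
      (F z - s⁻¹ * ∫ u in (0 : ℝ)..s, F (Φ.flow u z)) +
        s⁻¹ * ∫ u in (0 : ℝ)..s, H⁻¹ * ∫ t in u..(u + H), F (Φ.flow t z) :=
  defect_identity_of_flow Φ.flow Φ.good Φ.flow_add F hz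
    (hF.comp (AntiMazurCertificate.measurable_flow_orbit Φ hz)) hC hH W hW s

/-! ## The lag-average of window averages (plan step (4): Jensen in the lag variable + invariance) -/

section LagAverage

variable {N : ℕ} {ε : ℝ}

open BoltzmannGreenKuboOrthMomentum (flowMod flowMod_of_mem measurable_flowMod)

/-- Time integrals of a measurable observable along the MODIFIED (jointly measurable) flow are measurable
phase functions. [folklore] -/
theorem measurable_intervalIntegral_flowMod
    (Φ : HardSphereFlow (Literature.Analysis.FluidPDE.Torus.geometry (Fin 3)) ε N)
    {F : Config N (Fin 3) T3 → ℝ} (hF : Measurable F) (a b : ℝ) :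
    Measurable fun z : Config N (Fin 3) T3 => ∫ t in a..b, F (flowMod Φ (t, z)) := by
  have hI : Measurable (Function.uncurry fun (t : ℝ) (z : Config N (Fin 3) T3) => F (flowMod Φ (t, z))) :=
    hF.comp ((measurable_flowMod Φ).comp (measurable_fst.prodMk measurable_snd))
  have h : ∀ μ : Measure ℝ, SFinite μ →
      Measurable fun z : Config N (Fin 3) T3 => ∫ t, F (flowMod Φ (t, z)) ∂μ := fun μ _ =>
    (hI.stronglyMeasurable.integral_prod_left (μ := μ)).measurable
  simp only [intervalIntegral]
  exact (h _ inferInstance).sub (h _ inferInstance)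

/-- **The lag-average of window averages costs nothing** (plan step (4)): under a law preserved by the
flow and carried by the good set, for a bounded measurable observable `F`, an amplitude `c`, a horizon
`H > 0` and a lag `s > 0`,
`∫ exp(c · s⁻¹∫₀ˢ H⁻¹∫_u^{u+H} F(Φ_t z) dt du) dμ ≤ ∫ exp(c · H⁻¹∫₀ᴴ F(Φ_t z) dt) dμ`
(Jensen in `u`, Tonelli, and invariance: the window started at `u` is the window started at `0` read at
`Φ_u z`). [folklore] -/
theorem lintegral_exp_lagAverage_window_le
    (Φ : HardSphereFlow (Literature.Analysis.FluidPDE.Torus.geometry (Fin 3)) ε N)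
    (μ : Measure (Config N (Fin 3) T3)) [SFinite μ] (hinv : ∀ t, MeasurePreserving (Φ.flow t) μ μ)
    (hgood : μ Φ.goodᶜ = 0) {F : Config N (Fin 3) T3 → ℝ} (hF : Measurable F) {C : ℝ}
    (hC : ∀ z, |F z| ≤ C) (c : ℝ) {H s : ℝ} (hH : 0 < H) (hs : 0 < s) :
    ∫⁻ z, ENNReal.ofReal (Real.exp (c * (s⁻¹ * ∫ u in (0 : ℝ)..s,
        H⁻¹ * ∫ t in u..(u + H), F (Φ.flow t z)))) ∂μ ≤
      ∫⁻ z, ENNReal.ofReal (Real.exp (c * (H⁻¹ * ∫ t in (0 : ℝ)..H, F (Φ.flow t z)))) ∂μ := by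
  have hae : ∀ᵐ z ∂μ, z ∈ Φ.good := mem_ae_iff.2 hgood
  -- the window observable, as a measurable phase function (modified flow inside the time integral)
  set f₁ : Config N (Fin 3) T3 → ℝ := fun z => c * (H⁻¹ * ∫ t in (0 : ℝ)..H, F (flowMod Φ (t, z)))
    with hf₁
  have hf₁m : Measurable f₁ :=
    measurable_const.mul (measurable_const.mul (measurable_intervalIntegral_flowMod Φ hF 0 H))
  have hf₁C : ∀ z, |f₁ z| ≤ |c| * C := by
    intro z
    have hb : ‖∫ t in (0 : ℝ)..H, F (flowMod Φ (t, z))‖ ≤ C * |H - 0| :=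
      intervalIntegral.norm_integral_le_of_norm_le_const fun t _ => by
        rw [Real.norm_eq_abs]
        exact hC _
    rw [Real.norm_eq_abs, sub_zero, abs_of_pos hH] at hb
    simp only [hf₁, abs_mul, abs_inv, abs_of_pos hH]
    calc |c| * (H⁻¹ * |∫ t in (0 : ℝ)..H, F (flowMod Φ (t, z))|) ≤ |c| * (H⁻¹ * (C * H)) := by
          gcongr
      _ = |c| * C := by field_simp
  -- the window started at `0`, read along the true flow, on the good set
  have hf₁good : ∀ z ∈ Φ.good, f₁ z = c * (H⁻¹ * ∫ t in (0 : ℝ)..H, F (Φ.flow t z)) := by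
    intro z hz
    simp only [hf₁]
    congr 2
    exact intervalIntegral.integral_congr fun t _ => by simp only [flowMod_of_mem Φ hz]
  -- the window started at `u` is the window started at `0` read at `Φ_u z`
  have hshift : ∀ z ∈ Φ.good, ∀ u : ℝ,
      f₁ (Φ.flow u z) = c * (H⁻¹ * ∫ t in u..(u + H), F (Φ.flow t z)) := by
    intro z hz u
    rw [hf₁good _ (Φ.mapsTo_good u hz)]
    congr 2
    calc ∫ t in (0 : ℝ)..H, F (Φ.flow t (Φ.flow u z)) = ∫ t in (0 : ℝ)..H, F (Φ.flow (t + u) z) :=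
          intervalIntegral.integral_congr fun t _ => by simp only [Φ.flow_add t u z hz]
      _ = ∫ t in u..(u + H), F (Φ.flow t z) := by
          rw [intervalIntegral.integral_comp_add_right (fun t => F (Φ.flow t z)) u, zero_add, add_comm H u]
  have hLHS : ∀ᵐ z ∂μ, ENNReal.ofReal (Real.exp (c * (s⁻¹ * ∫ u in (0 : ℝ)..s,
      H⁻¹ * ∫ t in u..(u + H), F (Φ.flow t z)))) =
      ENNReal.ofReal (Real.exp (s⁻¹ * ∫ u in (0 : ℝ)..(0 + s), f₁ (Φ.flow u z))) := by
    filter_upwards [hae] with z hz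
    rw [zero_add, intervalIntegral.integral_congr fun u _ => hshift z hz u]
    simp only [intervalIntegral.integral_const_mul]
    ring_nf
  have hRHS : ∀ᵐ z ∂μ, ENNReal.ofReal (Real.exp (f₁ z)) =
      ENNReal.ofReal (Real.exp (c * (H⁻¹ * ∫ t in (0 : ℝ)..H, F (Φ.flow t z)))) := by
    filter_upwards [hae] with z hz
    rw [hf₁good z hz]
  calc ∫⁻ z, ENNReal.ofReal (Real.exp (c * (s⁻¹ * ∫ u in (0 : ℝ)..s,
          H⁻¹ * ∫ t in u..(u + H), F (Φ.flow t z)))) ∂μ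
      = ∫⁻ z, ENNReal.ofReal (Real.exp (s⁻¹ * ∫ u in (0 : ℝ)..(0 + s), f₁ (Φ.flow u z))) ∂μ :=
        lintegral_congr_ae hLHS
    _ ≤ ∫⁻ z, ENNReal.ofReal (Real.exp (f₁ z)) ∂μ :=
        AntiMazurCertificate.lintegral_exp_windowAverage_le Φ μ hinv hgood hf₁m hf₁C 0 hs
    _ = ∫⁻ z, ENNReal.ofReal (Real.exp (c * (H⁻¹ * ∫ t in (0 : ℝ)..H, F (Φ.flow t z)))) ∂μ :=
        lintegral_congr_ae hRHS

end LagAverage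

end FejerDefect

end Summit.AtomisticToContinuum.HydrodynamicLimit.Theorems

end
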